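import Summits.AtomisticToContinuum.Crystallization.Theorems.ChartedZeroExcessLayeredLatticeLiouvilleZZZYRCZQ

/-!
# Charted zero-excess layered-lattice Liouville — ZZZYRCZU: the WINDOWED KERNEL CONTRACT `KernelSlabSoundF` (item 5c, r1869 (C) §3)

Cell `decomp-a2c`, lens 2, generation 100.  The θ⁰ kernel contract of ZZZYRCX (`KernelSlabSound wd …`) is indexed by a PERIODIC word.  Under
«APERIODIC-COVER» (r1864 (A)(4)) and the window split of record (census «WINSPLIT57», r1867 (R1)(R3)(R4)(R6), r1869 (C): `H₀ = 5`, θ_out by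
max_σ per incidence key-wise, cut rule letter-quantified inside the kernel) the contract hand-1's windowed kernel RCXR must meet is, per WINDOW TYPE
(a word `wd` whose letters on layers `0 … 2H₀` are the window, centre `H₀`; hand-1: `wd := win ++ [0]`, period 12):

★ `KernelSlabSoundF H₀ R wd lo hi P9max E cd TRz TNz := ∀ ℓ, IsLetterSeq ℓ → AgreesOnWindow H₀ wd ℓ → ChordDataValidF H₀ R ℓ lo hi P9max cd ∧
   ∀ k, thetaR0G ℓ lo hi cd k ≤ TRz k / 2^E ∧ thetaN0G ℓ lo hi cd k ≤ TNz k / 2^E` — the letter sequence is quantified INSIDE (r1869 (C)(i)); ALL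
chords are CENTRE-BASED (`x.1 = (0, H₀)`, hand-1's base residue `mX := H₀`) in window coordinates; the tables are keyed by the RAW piece key
`pieceKeyF q = (q.1.2, Δγ₀, Δγ₁, Δm)` (= `(m_a − c + H₀, Δγ, Δm)`, the same key for in- and out-chords, (C)(ii)) and GUARDED by the ideal range
`lo < n9F ℓ c.1 ≤ hi` (an out-of-range σ-copy counts as zero, (C)(iii)); validity asks piece bounds only when the chord is in range under `ℓ`, paths within
`R` layers of the centre (`PiecesWithin H₀ R`), no duplicate pairs, and COMPLETENESS for every centre-based pair in range under `ℓ`.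
§3 splits it the way hand-1 produces it: ★ `kernelSlabSoundF_of_in_out : 2H₀ < wd.length → H₀ ≤ R → KernelSlabSoundIn … cdI TRI TNI →
KernelSlabSoundOut … cdO TRO TNO → KernelSlabSoundF … (cdI ++ cdO) (TRI + TRO) (TNI + TNO)`, where the IN half is `ℓ`-FREE and stated with ZZZYRCX's
periodic objects (`n9W wd`, `thetaR0/thetaN0 wd`, `pieceKeyW wd.length`) on chords whose whole path lies in the window — the conclusion of tree ZZZYRCXR
`kernelSlabSoundW_of_residue` at `r = MB = H₀` plus `c.1.1.2 = H₀` and `PiecesWithin H₀ H₀` per chord — and the OUT half is the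
`ℓ`-quantified guarded statement for chords leaving the window (RCXRK, σ-copies with `bumpMax`).  The join is letter LOCALITY (ZZZYRCZQ
`n9F_eq_of_letters`, `d18F_eq_of_letters`) + `pieceKeyW = pieceKeyF` on window layers.  The reader consuming `KernelSlabSoundF` (the windowed successor
of `thetaReaderNear_holds`: paths looked up in the window of the PAIR's base layer, `Θ(y)` = the sum over candidate base layers `m` of
`T(ω_m)(pieceKeyF of y re-based at m)`, `ω_m = windowWord ℓ (m − H₀) (2H₀+1)`) is the next lens-2 file; nothing here depends on it.
-/

namespace Summit.AtomisticToContinuum.Crystallization.Theorems.ChartedZeroExcessLayeredLatticeLiouville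

open scoped RealInnerProductSpace
open Summit.AtomisticToContinuum.Crystallization.Theorems.ChartedPlanarOrderRigidityDoor (E3)

/-! ### §1 window coordinates, raw keys, letter-function coefficients and guarded tables -/

/-- CENTRE-BASED pair in window coordinates: base site `(0, H₀)`. [g100] -/
def IsCenterBased (H₀ : ℕ) (x : (Cell 2 × ℤ) × (Cell 2 × ℤ)) : Prop := x.1.1 = 0 ∧ x.1.2 = (H₀ : ℤ)

/-- `ℓ` agrees with the window word on the window layers `0 … 2H₀`. [g100] -/
def AgreesOnWindow (H₀ : ℕ) (wd : List ℤ) (ℓ : ℤ → ℤ) : Prop := ∀ j : ℤ, 0 ≤ j → j ≤ 2 * (H₀ : ℤ) → ℓ j = regW wd j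

/-- the RAW piece key `(m, Δγ₀, Δγ₁, Δm)` (no reduction of the base layer). [g100] -/
def pieceKeyF (q : (Cell 2 × ℤ) × (Cell 2 × ℤ)) : ℤ × ℤ × ℤ × ℤ := (q.1.2, q.2.1 0 - q.1.1 0, q.2.1 1 - q.1.1 1, q.2.2 - q.1.2)

/-- on layers `0 ≤ m < p` the periodic key is the raw key. [g100] -/
theorem pieceKeyW_eq_pieceKeyF {p : ℕ} {q : (Cell 2 × ℤ) × (Cell 2 × ℤ)} (h0 : 0 ≤ q.1.2) (hp : q.1.2 < (p : ℤ)) :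
    pieceKeyW p q = pieceKeyF q := by
  simp only [pieceKeyW, pieceKeyF, Int.emod_eq_of_lt h0 hp]

/-- ideal R coefficient of one incidence under the letter sequence `ℓ`. [g100] -/
noncomputable def coefR0F (ℓ : ℤ → ℤ) (c : ChordDatum) : ℝ := (chordNp c : ℝ) * 45927 / (n9F ℓ c.1 : ℝ) ^ 4
/-- ideal N coefficient of incidence `i` under `ℓ`. [g100] -/
noncomputable def coefN0F (ℓ : ℤ → ℤ) (c : ChordDatum) (i : ℕ) : ℝ :=
  (chordNp c : ℝ) * 45927 * (1 - (d18F ℓ c.1 (chordPiece c i) : ℝ) ^ 2 / (4 * n9F ℓ c.1 * n9F ℓ (chordPiece c i))) /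
    (n9F ℓ c.1 : ℝ) ^ 4

/-- bridge: `coefR0F (regW wd) = coefR0 wd`. [g100] -/
theorem coefR0F_regW (wd : List ℤ) (c : ChordDatum) : coefR0F (regW wd) c = coefR0 wd c := rfl
/-- bridge: `coefN0F (regW wd) = coefN0 wd`. [g100] -/
theorem coefN0F_regW (wd : List ℤ) (c : ChordDatum) (i : ℕ) : coefN0F (regW wd) c i = coefN0 wd c i := rfl

/-- ★ GUARDED ideal R table under `ℓ` at raw key `k`: incidences of the chords IN RANGE `lo < n9F ℓ c.1 ≤ hi` (an out-of-range chord counts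
as zero — the letter-quantified near/far cut of r1867 (R3), r1869 (C)(iii)). [g100] -/
noncomputable def thetaR0G (ℓ : ℤ → ℤ) (lo hi : ℤ) (cd : List ChordDatum) (k : ℤ × ℤ × ℤ × ℤ) : ℝ :=
  (cd.map fun c => if lo < n9F ℓ c.1 ∧ n9F ℓ c.1 ≤ hi then
      ∑ i ∈ Finset.range (chordNp c), (if pieceKeyF (chordPiece c i) = k then coefR0F ℓ c else 0) else 0).sum
/-- ★ GUARDED ideal N table under `ℓ` at raw key `k`. [g100] -/
noncomputable def thetaN0G (ℓ : ℤ → ℤ) (lo hi : ℤ) (cd : List ChordDatum) (k : ℤ × ℤ × ℤ × ℤ) : ℝ :=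
  (cd.map fun c => if lo < n9F ℓ c.1 ∧ n9F ℓ c.1 ≤ hi then
      ∑ i ∈ Finset.range (chordNp c), (if pieceKeyF (chordPiece c i) = k then coefN0F ℓ c i else 0) else 0).sum

/-- every piece endpoint of the datum lies within `R` layers of the base layer `m₀` (for in-window chords `R = H₀`: the whole path is in
the window — hand-1's decided `layersWithin`-type check extended to the interior nodes). [g100] -/
def PiecesWithin (m₀ : ℤ) (R : ℕ) (c : ChordDatum) : Prop :=
  ∀ i < chordNp c, |(chordPiece c i).1.2 - m₀| ≤ R ∧ |(chordPiece c i).2.2 - m₀| ≤ R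

/-- `PiecesWithin` is monotone in the radius. [g100] -/
theorem piecesWithin_mono {m₀ : ℤ} {R R' : ℕ} {c : ChordDatum} (hR : R ≤ R') (h : PiecesWithin m₀ R c) : PiecesWithin m₀ R' c :=
  fun i hi => ⟨(h i hi).1.trans (by exact_mod_cast hR), (h i hi).2.trans (by exact_mod_cast hR)⟩

/-- the far endpoint is the end of the last piece, hence within the radius too. [g100] -/
theorem far_within_of_piecesWithin {m₀ : ℤ} {R : ℕ} {c : ChordDatum} (h : PiecesWithin m₀ R c) : |c.1.2.2 - m₀| ≤ R := by
  have hnp : chordNp c - 1 + 1 = chordNp c := Nat.sub_add_cancel (Nat.succ_le_of_lt (Nat.succ_pos _))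
  have hlast := (h (chordNp c - 1) (Nat.sub_lt (Nat.succ_pos _) Nat.one_pos)).2
  simp only [chordPiece] at hlast
  rwa [hnp, chordNodes_getD_np] at hlast

/-! ### §2 the contract -/

/-- ★ VALID WINDOW DATA under `ℓ` for the ideal range `(lo, hi]`: centre-based chords with paths within `R` layers of the centre, piece bounds
`0 < n9F ≤ P9max` whenever the chord is in range under `ℓ`, no duplicate pairs, and every centre-based pair in range under `ℓ` has a datum. [g100] -/
def ChordDataValidF (H₀ R : ℕ) (ℓ : ℤ → ℤ) (lo hi P9max : ℤ) (cd : List ChordDatum) : Prop :=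
  (∀ c ∈ cd, IsCenterBased H₀ c.1 ∧ PiecesWithin H₀ R c ∧
      (lo < n9F ℓ c.1 → n9F ℓ c.1 ≤ hi → ∀ i < chordNp c, 0 < n9F ℓ (chordPiece c i) ∧ n9F ℓ (chordPiece c i) ≤ P9max)) ∧
    (cd.map (·.1)).Nodup ∧
    ∀ x : (Cell 2 × ℤ) × (Cell 2 × ℤ), IsCenterBased H₀ x → lo < n9F ℓ x → n9F ℓ x ≤ hi → ∃ c ∈ cd, c.1 = x

/-- ★★ **THE WINDOWED KERNEL CONTRACT** for the window type carried by `wd` (letters on layers `0 … 2H₀`): for EVERY letter sequence agreeing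
with the window, valid data and guarded table majorants at dyadic exponent `E` (r1869 (C)(i)–(iii)). [g100] -/
def KernelSlabSoundF (H₀ R : ℕ) (wd : List ℤ) (lo hi P9max : ℤ) (E : ℕ) (cd : List ChordDatum) (TRz TNz : ℤ × ℤ × ℤ × ℤ → ℤ) :
    Prop :=
  ∀ ℓ : ℤ → ℤ, IsLetterSeq ℓ → AgreesOnWindow H₀ wd ℓ →
    ChordDataValidF H₀ R ℓ lo hi P9max cd ∧ ∀ k, thetaR0G ℓ lo hi cd k ≤ (TRz k : ℝ) / 2 ^ E ∧ thetaN0G ℓ lo hi cd k ≤ (TNz k : ℝ) / 2 ^ E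

/-! ### §3 the two halves hand-1 produces, and their join -/

/-- **IN half** (letter-free; ZZZYRCX's periodic objects on the window word): centre-based chords with the WHOLE PATH in the window
(`PiecesWithin H₀ H₀`), in range and piece-valid for `n9W wd`, no duplicates, completeness for based pairs at layer `H₀` in the layer window, the
two table majorants — the conclusion of hand-1's `kernelSlabSoundW_of_residue` (tree ZZZYRCXR, `r = MB = H₀`) plus the two per-chord facts
`c.1.1.2 = H₀` (by `decodeChord`) and `PiecesWithin` (a decided check on all nodes, not only the far one). [g100] -/
def KernelSlabSoundIn (H₀ : ℕ) (wd : List ℤ) (lo hi P9max : ℤ) (E : ℕ) (cd : List ChordDatum) (TRz TNz : ℤ × ℤ × ℤ × ℤ → ℤ) : Prop :=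
  (∀ c ∈ cd, c.1.1.1 = 0 ∧ c.1.1.2 = (H₀ : ℤ) ∧ PiecesWithin H₀ H₀ c ∧ lo < n9W wd c.1 ∧ n9W wd c.1 ≤ hi ∧
      ∀ i < chordNp c, 0 < n9W wd (chordPiece c i) ∧ n9W wd (chordPiece c i) ≤ P9max) ∧
    (cd.map (·.1)).Nodup ∧
    (∀ y : Cell 2 × ℤ, |y.2 - H₀| ≤ H₀ → lo < n9W wd (((0 : Cell 2), (H₀ : ℤ)), y) → n9W wd (((0 : Cell 2), (H₀ : ℤ)), y) ≤ hi →
      ∃ c ∈ cd, c.1 = (((0 : Cell 2), (H₀ : ℤ)), y)) ∧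
    ∀ k, thetaR0 wd cd k ≤ (TRz k : ℝ) / 2 ^ E ∧ thetaN0 wd cd k ≤ (TNz k : ℝ) / 2 ^ E

/-- **OUT half** (letter-quantified; RCXRK with σ-copies): centre-based chords whose far layer LEAVES the window, paths within `R` layers
of the centre, piece bounds when in range under `ℓ`, no duplicates, completeness for centre-based out-of-window pairs in range under `ℓ`,
guarded table majorants. [g100] -/
def KernelSlabSoundOut (H₀ R : ℕ) (wd : List ℤ) (lo hi P9max : ℤ) (E : ℕ) (cd : List ChordDatum) (TRz TNz : ℤ × ℤ × ℤ × ℤ → ℤ) :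
    Prop :=
  ∀ ℓ : ℤ → ℤ, IsLetterSeq ℓ → AgreesOnWindow H₀ wd ℓ →
    (∀ c ∈ cd, IsCenterBased H₀ c.1 ∧ (H₀ : ℤ) < |c.1.2.2 - H₀| ∧ PiecesWithin H₀ R c ∧
        (lo < n9F ℓ c.1 → n9F ℓ c.1 ≤ hi → ∀ i < chordNp c, 0 < n9F ℓ (chordPiece c i) ∧ n9F ℓ (chordPiece c i) ≤ P9max)) ∧
      (cd.map (·.1)).Nodup ∧
      (∀ x : (Cell 2 × ℤ) × (Cell 2 × ℤ), IsCenterBased H₀ x → (H₀ : ℤ) < |x.2.2 - H₀| → lo < n9F ℓ x → n9F ℓ x ≤ hi →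
        ∃ c ∈ cd, c.1 = x) ∧
      ∀ k, thetaR0G ℓ lo hi cd k ≤ (TRz k : ℝ) / 2 ^ E ∧ thetaN0G ℓ lo hi cd k ≤ (TNz k : ℝ) / 2 ^ E

/-- letters of an in-window chord and of its pieces are window letters: `n9F ℓ = n9W wd` on the chord and on every piece, `d18F ℓ = d18W wd` on
(chord, piece), and the periodic key of every piece is its raw key. [g100] -/
theorem inChord_letters {H₀ : ℕ} {wd : List ℤ} {ℓ : ℤ → ℤ} (hp : 2 * (H₀ : ℤ) < (wd.length : ℤ)) (hℓ : AgreesOnWindow H₀ wd ℓ) {c : ChordDatum}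
    (hb : c.1.1.2 = (H₀ : ℤ)) (hw : PiecesWithin H₀ H₀ c) :
    n9F ℓ c.1 = n9W wd c.1 ∧ ∀ i < chordNp c, n9F ℓ (chordPiece c i) = n9W wd (chordPiece c i) ∧
      d18F ℓ c.1 (chordPiece c i) = d18W wd c.1 (chordPiece c i) ∧ pieceKeyW wd.length (chordPiece c i) = pieceKeyF (chordPiece c i) := by
  have hH : (0 : ℤ) ≤ (H₀ : ℤ) := Int.natCast_nonneg _
  have key : ∀ m : ℤ, |m - H₀| ≤ (H₀ : ℕ) → ℓ m = regW wd m ∧ 0 ≤ m ∧ m < (wd.length : ℤ) := fun m hm => by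
    obtain ⟨h₁, h₂⟩ := abs_le.1 hm
    exact ⟨hℓ m (by linarith) (by linarith), by linarith, by linarith⟩
  have e₁ : ℓ c.1.1.2 = regW wd c.1.1.2 := (key _ (by rw [hb, sub_self, abs_zero]; positivity)).1
  have e₂ : ℓ c.1.2.2 = regW wd c.1.2.2 := (key _ (far_within_of_piecesWithin hw)).1
  refine ⟨n9F_eq_of_letters e₁ e₂, fun i hi => ?_⟩
  obtain ⟨q₁, q₂⟩ := hw i hi
  obtain ⟨f₁, g₁, g₂⟩ := key _ q₁
  exact ⟨n9F_eq_of_letters f₁ (key _ q₂).1, d18F_eq_of_letters e₁ e₂ f₁ (key _ q₂).1, pieceKeyW_eq_pieceKeyF g₁ g₂⟩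

/-- on in-window data the guarded letter-function tables ARE the periodic tables of the window word. [g100] -/
theorem thetaG_eq_of_in {H₀ : ℕ} {wd : List ℤ} {ℓ : ℤ → ℤ} {lo hi : ℤ} {cd : List ChordDatum} (hp : 2 * (H₀ : ℤ) < (wd.length : ℤ))
    (hℓ : AgreesOnWindow H₀ wd ℓ)
    (hcd : ∀ c ∈ cd, c.1.1.2 = (H₀ : ℤ) ∧ PiecesWithin H₀ H₀ c ∧ lo < n9W wd c.1 ∧ n9W wd c.1 ≤ hi) (k : ℤ × ℤ × ℤ × ℤ) :
    thetaR0G ℓ lo hi cd k = thetaR0 wd cd k ∧ thetaN0G ℓ lo hi cd k = thetaN0 wd cd k := by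
  constructor
  · unfold thetaR0G thetaR0
    congr 1
    refine List.map_congr_left fun c hc => ?_
    obtain ⟨hb, hsp, hlo, hhi⟩ := hcd c hc
    obtain ⟨hn, hpc⟩ := inChord_letters hp hℓ hb hsp
    rw [if_pos (by rw [hn]; exact ⟨hlo, hhi⟩)]
    refine Finset.sum_congr rfl fun i hi => ?_
    rw [(hpc i (Finset.mem_range.1 hi)).2.2, coefR0F, hn, coefR0]
  · unfold thetaN0G thetaN0
    congr 1
    refine List.map_congr_left fun c hc => ?_
    obtain ⟨hb, hsp, hlo, hhi⟩ := hcd c hc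
    obtain ⟨hn, hpc⟩ := inChord_letters hp hℓ hb hsp
    rw [if_pos (by rw [hn]; exact ⟨hlo, hhi⟩)]
    refine Finset.sum_congr rfl fun i hi => ?_
    obtain ⟨hni, hdi, hki⟩ := hpc i (Finset.mem_range.1 hi)
    rw [hki, coefN0F, hn, hni, hdi, coefN0]

/-- guarded tables are additive in the data. [g100] -/
theorem thetaG_append (ℓ : ℤ → ℤ) (lo hi : ℤ) (cd₁ cd₂ : List ChordDatum) (k : ℤ × ℤ × ℤ × ℤ) :
    thetaR0G ℓ lo hi (cd₁ ++ cd₂) k = thetaR0G ℓ lo hi cd₁ k + thetaR0G ℓ lo hi cd₂ k ∧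
      thetaN0G ℓ lo hi (cd₁ ++ cd₂) k = thetaN0G ℓ lo hi cd₁ k + thetaN0G ℓ lo hi cd₂ k := by
  simp only [thetaR0G, thetaN0G, List.map_append, List.sum_append, and_self]

/-- ★ **THE JOIN**: IN half + OUT half ⇒ the windowed contract on the concatenated data with the summed tables (`H₀ ≤ R`, `2H₀ < |wd|`). [g100] -/
theorem kernelSlabSoundF_of_in_out {H₀ R : ℕ} {wd : List ℤ} {lo hi P9max : ℤ} {E : ℕ} {cdI cdO : List ChordDatum}
    {TRI TNI TRO TNO : ℤ × ℤ × ℤ × ℤ → ℤ} (hp : 2 * (H₀ : ℤ) < (wd.length : ℤ)) (hR : H₀ ≤ R)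
    (hI : KernelSlabSoundIn H₀ wd lo hi P9max E cdI TRI TNI) (hO : KernelSlabSoundOut H₀ R wd lo hi P9max E cdO TRO TNO) :
    KernelSlabSoundF H₀ R wd lo hi P9max E (cdI ++ cdO) (fun k => TRI k + TRO k) fun k => TNI k + TNO k := by
  intro ℓ hℓ hag
  obtain ⟨hcI, hndI, hcomplI, htabI⟩ := hI
  obtain ⟨hcO, hndO, hcomplO, htabO⟩ := hO ℓ hℓ hag
  have hcI' : ∀ c ∈ cdI, c.1.1.2 = (H₀ : ℤ) ∧ PiecesWithin H₀ H₀ c ∧ lo < n9W wd c.1 ∧ n9W wd c.1 ≤ hi :=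
    fun c hc => let h := hcI c hc; ⟨h.2.1, h.2.2.1, h.2.2.2.1, h.2.2.2.2.1⟩
  refine ⟨⟨fun c hc => ?_, ?_, fun x hb hlo hhi => ?_⟩, fun k => ?_⟩
  · rcases List.mem_append.1 hc with hc | hc
    · obtain ⟨hb0, hb, hsp, -, -, hpcs⟩ := hcI c hc
      obtain ⟨-, hpc⟩ := inChord_letters hp hag hb hsp
      exact ⟨⟨hb0, hb⟩, piecesWithin_mono hR hsp, fun _ _ i hi => by rw [(hpc i hi).1]; exact hpcs i hi⟩
    · obtain ⟨hb, -, hsp, hpcs⟩ := hcO c hc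
      exact ⟨hb, hsp, hpcs⟩
  · rw [List.map_append]
    refine List.nodup_append.2 ⟨hndI, hndO, fun x hxI x' hxO hxx => ?_⟩
    obtain ⟨c, hc, rfl⟩ := List.mem_map.1 hxI
    obtain ⟨c', hc', he⟩ := List.mem_map.1 hxO
    obtain ⟨-, -, hsp, -⟩ := hcI c hc
    obtain ⟨-, hout, -⟩ := hcO c' hc'
    have hin := far_within_of_piecesWithin hsp
    rw [he, ← hxx] at hout
    exact absurd hin (not_le.2 hout)
  · have hx : x = (((0 : Cell 2), (H₀ : ℤ)), x.2) := Prod.ext (Prod.ext hb.1 hb.2) rfl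
    rcases le_or_gt |x.2.2 - H₀| (H₀ : ℤ) with hin | hout
    · have hH : (0 : ℤ) ≤ (H₀ : ℤ) := Int.natCast_nonneg _
      obtain ⟨h₁, h₂⟩ := abs_le.1 hin
      have e₁ : ℓ x.1.2 = regW wd x.1.2 := by rw [hb.2]; exact hag _ hH (by linarith)
      have hn : n9F ℓ x = n9W wd x := n9F_eq_of_letters e₁ (hag _ (by linarith) (by linarith))
      rw [hn, hx] at hlo hhi
      obtain ⟨c, hc, hcx⟩ := hcomplI x.2 (by exact_mod_cast hin) hlo hhi
      exact ⟨c, List.mem_append_left _ hc, hcx.trans hx.symm⟩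
    · obtain ⟨c, hc, hcx⟩ := hcomplO x hb hout hlo hhi
      exact ⟨c, List.mem_append_right _ hc, hcx⟩
  · obtain ⟨hR', hN⟩ := thetaG_append ℓ lo hi cdI cdO k
    obtain ⟨hRI, hNI⟩ := thetaG_eq_of_in hp hag hcI' k
    obtain ⟨h₁, h₂⟩ := htabI k
    obtain ⟨h₃, h₄⟩ := htabO k
    rw [hR', hN, hRI, hNI]
    push_cast
    rw [add_div, add_div]
    exact ⟨add_le_add h₁ h₃, add_le_add h₂ h₄⟩

/-- CONSISTENCY: a purely in-window contract (no out-of-window pair is ever in range, zero out-tables) is a windowed contract. [g100] -/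
theorem kernelSlabSoundF_of_in {H₀ : ℕ} {wd : List ℤ} {lo hi P9max : ℤ} {E : ℕ} {cd : List ChordDatum} {TRz TNz : ℤ × ℤ × ℤ × ℤ → ℤ}
    (hp : 2 * (H₀ : ℤ) < (wd.length : ℤ)) (hI : KernelSlabSoundIn H₀ wd lo hi P9max E cd TRz TNz)
    (hout : ∀ ℓ : ℤ → ℤ, IsLetterSeq ℓ → AgreesOnWindow H₀ wd ℓ → ∀ x : (Cell 2 × ℤ) × (Cell 2 × ℤ), IsCenterBased H₀ x →
      (H₀ : ℤ) < |x.2.2 - H₀| → lo < n9F ℓ x → ¬ n9F ℓ x ≤ hi) :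
    KernelSlabSoundF H₀ H₀ wd lo hi P9max E cd TRz TNz := by
  have h := kernelSlabSoundF_of_in_out (cdO := []) (TRO := fun _ => 0) (TNO := fun _ => 0) hp le_rfl hI fun ℓ hℓ hag =>
    ⟨fun c hc => by simp at hc, by simp, fun x hb ho hlo hhi => absurd hhi (hout ℓ hℓ hag x hb ho hlo), fun k => by
      simp [thetaR0G, thetaN0G]⟩
  simpa using h

end Summit.AtomisticToContinuum.Crystallization.Theorems.ChartedZeroExcessLayeredLatticeLiouville
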